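import Summits.Ventures.PercRepro.S1CoreCapSevenThree

/-!
# PercRepro — TOWARDS `Q*(8)`: THREE BIG LINES IN A PLANE (p1, gen 27)

The `ν = 8` reading of `S1CoreCapSevenThree`: three lines `L₁, L₂, L₃` of `≥ 4` points with
`lineRank [L₃, L₂, L₁] ≤ 3` — the plane on them has `≤ 9` points (`h5`) and contains their union of `≥ 9`, so it
IS the union (`Seven.plane_of_three_big`): three simple-or-one-fat 4-point lines meeting pairwise, the TRIANGLE.
Its other lines are at most four transversals (`Seven.card_transversals_le_four`), a fat point of it lies on at
most `3` of its lines (`Seven.sum_fat_plane_le'`), the cost `9 + f₀ − 3 ≤ 8` allows `f₀ ≤ 2` fat points, and the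
thin family outside has budget `2 − f₀`: cap `≤ 12 + 4 + 3 f₀ + (2 − f₀)(3 − f₀)/2 + f₀ (2 − f₀)`, i.e.
`19 / 21 / 22` at `f₀ = 0 / 1 / 2` — `sum_cap_le_twenty_two_of_three_big_plane`. (The value `22` is attained:
the triangle with two fat private points on different big lines, `5 + 5 + 4 + 3 + 2 + 2 + 1`.)
`proofs/P1-S4-CAPBRIDGE.md` §19. Axioms: standard.
-/

namespace PercRepro

namespace S1

namespace FourCap

namespace Eight

open Seven

variable {β : Type} [DecidableEq β]

section ThreeBig

variable {w : β → ℕ} {ls : Finset (Finset β)}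
  (h1 : ∀ L ∈ ls, ∀ v ∈ L, w v = 1 ∨ w v = 2)
  (h2 : ∀ L ∈ ls, 3 ≤ L.card ∧ wsum w L ≤ 5)
  (h3 : ∀ L ∈ ls, ∀ L' ∈ ls, L ≠ L' → (L ∩ L').card ≤ 1)
  (h4 : ∀ l : List (Finset β), l.Nodup → (∀ L ∈ l, L ∈ ls) → wsum w (unionL l) ≤ 8 + lineRank l)
  (h5 : ∀ l : List (Finset β), l.Nodup → (∀ L ∈ l, L ∈ ls) → lineRank l ≤ 3 → (unionL l).card ≤ 9)
  {L₁ L₂ L₃ : Finset β} (hL₁ : L₁ ∈ ls) (hL₂ : L₂ ∈ ls) (hL₃ : L₃ ∈ ls)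
  (h12 : L₂ ≠ L₁) (h13 : L₃ ≠ L₁) (h23 : L₃ ≠ L₂)
  (c1 : 4 ≤ L₁.card) (c2 : 4 ≤ L₂.card) (c3 : 4 ≤ L₃.card)
  (hrest : ∀ L ∈ ls, L ≠ L₁ → L ≠ L₂ → L ≠ L₃ → L.card = 3)

include h1 h2 h3 h4 h5 hL₁ hL₂ hL₃ h12 h13 h23 c1 c2 c3 hrest in
/-- **Three big lines in a plane at nullity `8`: cap sum `≤ 22`** — given `lineRank [L₃, L₂, L₁] ≤ 3`, the plane
on them is their union of nine points (three 4-point lines meeting pairwise), its other lines are at most four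
transversals, a fat point of it lies on at most three of its lines and there are at most two, and the thin family
outside has budget `2 − f₀`: cap `≤ 12 + 4 + 3 f₀ + (2 − f₀)(3 − f₀)/2 + f₀ (2 − f₀)`. -/
theorem sum_cap_le_twenty_two_of_three_big_plane (hr : lineRank [L₃, L₂, L₁] ≤ 3) :
    ∑ L ∈ ls, capPaper L.card (fat w L) ≤ 22 := by
  have h2' := two_le_card_of_spec₇ h2
  obtain ⟨l, hnd, hls, hr', hsub, hmax⟩ := exists_plane ls _ [L₃, L₂, L₁] le_rfl (by simp [h12, h13, h23])
    (by simp [hL₁, hL₂, hL₃]) hr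
  have hc9 : (unionL l).card ≤ 9 := card_plane_le_nine h5 hnd hls hr'
  obtain ⟨hU, hc, k1, k2, k3, e21, e3⟩ := plane_of_three_big h3 hL₁ hL₂ hL₃ h12 h13 h23 c1 c2 c3
    (hsub L₁ (by simp)) (hsub L₂ (by simp)) (hsub L₃ (by simp)) hc9
  -- the fat points of the plane: at most two, each on at most three of its lines
  have hfatin := sum_fat_plane_le' w l (fun L hL => (h2 L (hls L hL)).1)
    (fun L hL L' hL' hne => h3 L (hls L hL) L' (hls L' hL') hne) (fun p hp => by
      rw [hU] at hp
      rcases Finset.mem_union.1 hp with h | h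
      · exact ⟨L₃, hsub L₃ (by simp), h, c3⟩
      rcases Finset.mem_union.1 h with h | h
      · exact ⟨L₂, hsub L₂ (by simp), h, c2⟩
      · exact ⟨L₁, hsub L₁ (by simp), h, c1⟩)
  rw [hc] at hfatin
  have hcs := wsum_unionL_eq w l (fun L hL => h1 L (hls L hL)) (fun L hL => h2' L (hls L hL))
  rw [wsum_eq_card_add_fat w (unionL l) (fun v hv => by
    obtain ⟨L, hL, hvL⟩ := mem_unionL_iff.1 hv
    exact h1 L (hls L hL) v hvL)] at hcs
  have hcost : (unionL l).card + fat w (unionL l) ≤ 11 := by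
    have hb := costSum_le h1 h2' h4 l hnd hls
    omega
  -- the thin family outside
  set T := ls.filter (fun L => L ∉ l) with hT
  have hTmem : ∀ L ∈ T, L ∈ ls ∧ L ∉ l := fun L hL => Finset.mem_filter.1 hL
  have hT3 : ∀ L ∈ T, L.card = 3 := fun L hL => hrest L (hTmem L hL).1
    (fun h => (hTmem L hL).2 (h ▸ hsub L₁ (by simp))) (fun h => (hTmem L hL).2 (h ▸ hsub L₂ (by simp)))
    (fun h => (hTmem L hL).2 (h ▸ hsub L₃ (by simp)))
  have hk : ∀ t : List (Finset β), t.Nodup → (∀ L ∈ t, L ∈ T) →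
      freeCountR (unionL l) t + fat w (unionLR (unionL l) t \ unionL l) ≤
        11 - (unionL l).card - fat w (unionL l) := by
    intro t hndt hlt
    have hb := budget_of_prefix h1 h2' h4 l t (by
      rw [List.nodup_append']
      exact ⟨hndt, hnd, fun L hLt hLl => (hTmem L (hlt L hLt)).2 hLl⟩)
      (fun L hL => by
        rcases List.mem_append.1 hL with hL | hL
        · exact (hTmem L (hlt L hL)).1
        · exact hls L hL)
      (fun L hL => hT3 L (hlt L hL))
    have hsplit := fat_sdiff_add_fat_of_subset w (subset_unionLR (unionL l) t)
    omega
  have hthin := two_mul_sum_cap_thin_le w (unionL l) T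
    (fun L hL => ⟨hT3 L hL, hmax L (hTmem L hL).1 (hTmem L hL).2⟩)
    (fun L hL L' hL' hne => h3 L (hTmem L hL).1 L' (hTmem L' hL').1 hne)
    (fun L hL => h1 L (hTmem L hL).1) (fun L hL => (h2 L (hTmem L hL).1).2) hk
  rw [hc] at hthin hcost
  -- the plane: the three big lines and the transversals
  set S := ((l.toFinset.erase L₁).erase L₂).erase L₃ with hS
  have hSmem : ∀ X ∈ S, X ∈ l ∧ X ≠ L₁ ∧ X ≠ L₂ ∧ X ≠ L₃ := fun X hX => by
    have h3' := Finset.mem_erase.1 hX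
    have h2'' := Finset.mem_erase.1 h3'.2
    have h1' := Finset.mem_erase.1 h2''.2
    exact ⟨List.mem_toFinset.1 h1'.2, h1'.1, h2''.1, h3'.1⟩
  have hS4 : S.card ≤ 4 := card_transversals_le_four h3 hL₁ hL₂ hL₃ h13 h23 k1 k2 e21 e3 S
    (fun X hX => by
      obtain ⟨hXl, hX1, hX2, hX3⟩ := hSmem X hX
      refine ⟨hls X hXl, hX1, hX2, hX3, hrest X (hls X hXl) hX1 hX2 hX3, ?_⟩
      rw [← hU]
      exact fun v hv => mem_unionL_iff.2 ⟨X, hXl, hv⟩)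
  -- the sum over the plane
  have hsplit := Finset.sum_filter_add_sum_filter_not ls (fun L => L ∈ l) (fun L => capPaper L.card (fat w L))
  have hfil : ls.filter (fun L => L ∈ l) = l.toFinset := by
    ext L
    simp only [Finset.mem_filter, List.mem_toFinset]
    exact ⟨fun h => h.2, fun h => ⟨hls L h, h⟩⟩
  rw [hfil, ← hT] at hsplit
  rw [← hsplit]
  have hL₁l : L₁ ∈ l.toFinset := List.mem_toFinset.2 (hsub L₁ (by simp))
  have hL₂l : L₂ ∈ (l.toFinset.erase L₁) := Finset.mem_erase.2 ⟨h12, List.mem_toFinset.2 (hsub L₂ (by simp))⟩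
  have hL₃l : L₃ ∈ ((l.toFinset.erase L₁).erase L₂) :=
    Finset.mem_erase.2 ⟨h23, Finset.mem_erase.2 ⟨h13, List.mem_toFinset.2 (hsub L₃ (by simp))⟩⟩
  have hcap4 : ∀ L ∈ ls, L.card = 4 → capPaper L.card (fat w L) = 4 + fat w L := by
    intro L hL hc4
    have := wsum_eq_card_add_fat w L (h1 L hL)
    have := (h2 L hL).2
    rw [hc4, capPaper_four_eq (by omega)]
  have hcap3 : ∀ X ∈ S, capPaper X.card (fat w X) = 1 + fat w X := by
    intro X hX
    obtain ⟨hXl, hX1, hX2, hX3⟩ := hSmem X hX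
    have hXls := hls X hXl
    have := wsum_eq_card_add_fat w X (h1 X hXls)
    have := (h2 X hXls).2
    have hXc := hrest X hXls hX1 hX2 hX3
    rw [hXc, capPaper_three_eq' (by omega)]
  have esum : ∀ f : Finset β → ℕ, ∑ L ∈ l.toFinset, f L = f L₁ + (f L₂ + (f L₃ + ∑ X ∈ S, f X)) := by
    intro f
    rw [← Finset.add_sum_erase _ f hL₁l, ← Finset.add_sum_erase _ f hL₂l, ← Finset.add_sum_erase _ f hL₃l]
  rw [esum, hcap4 L₁ hL₁ k1, hcap4 L₂ hL₂ k2, hcap4 L₃ hL₃ k3, Finset.sum_congr rfl hcap3,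
    Finset.sum_add_distrib, Finset.sum_const_nat (m := 1) (fun _ _ => rfl), Nat.mul_one]
  rw [esum] at hfatin
  have hf2 : fat w (unionL l) ≤ 2 := by omega
  rcases (by omega : fat w (unionL l) = 0 ∨ fat w (unionL l) = 1 ∨ fat w (unionL l) = 2) with hf | hf | hf <;>
    rw [hf] at hthin hfatin <;> omega

end ThreeBig

end Eight

end FourCap

end S1

end PercRepro
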